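import Summits.Ventures.PercRepro.ProfileTwoDeletion
import Summits.Ventures.PercRepro.ProfileTwoDeletionExists

/-!
# PercRepro — THE TOP LEVEL OF `INDEP_2` ON SIMPLE MATROIDS, BY DUALITY
(p10, gen 3; S5 §2.5 (b′) of `proofs/SUBCLAIM-S5-p10.md`)

At the top level `u = ρ(E)` the inequality `INDEP_{2,ρ(E)}` reads: the pairs whose complement spans (the
COINDEPENDENT pairs) are at most the bases.  By duality these pairs are the independent pairs of `M✶`, which
has cogirth `≥ 3` when `M` is simple (a set missing at most two elements spans `M✶` because its complement is
independent in `M`), and Theorem C (`indep_demand_le_choose_mul_card_indepSets`, ProfileIndepCogirth) on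
`M✶` at its own top level `ρ(M✶)` bounds them by the bases of `M✶`, which are the complements of the bases
of `M`.  Ranks `≤ 2` and nullity `≤ 1` are degenerate and handled directly.

With the existential assembly `indep2_of_delStep_exists` (ProfileTwoDeletionExists) this discharges the
top-level hypothesis: `INDEP_{2,u}` on every simple matroid follows from ONE deletion step per simple matroid
and level `3 ≤ u ≤ ρ(E) − 1` with `≥ u + 3` elements (`indep2_of_delStep_exists_below`).

* `gr_dual`, `eRank_eq_coe_rk`, `spanning_iff_rk_eq`, `dual_indep_iff_spanning_compl`,
  `dual_spanning_iff_indep_compl`, `rk_dual_add_rk` — dual bookkeeping in the cell's finset vocabulary;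
* `cogirthGe'_dual_three` — `M` simple ⟹ `M✶` has cogirth `≥ 3`;
* `indepSets_dual_two`, `card_indepSets_dual_rank` — the pair and base correspondences;
* **`indep2_top`** — `INDEP_{2,ρ(E)}` on every simple matroid;
* **`indep2_of_delStep_exists_below`** — the assembly with only the steps below the top level.
-/

open scoped Matroid
namespace PercRepro.Cogirth
open Finset ThmH Skew Shadow Profile
variable {α : Type} [DecidableEq α] {M : Matroid α} [M.Finite]

omit [DecidableEq α] in
/-- The ground finset of the dual. -/
theorem gr_dual : gr (M✶) = gr M := by
  apply Finset.coe_injective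
  rw [coe_gr, coe_gr, Matroid.dual_ground]

omit [DecidableEq α] in
/-- `M.eRank` is the natural rank of the ground finset. -/
theorem eRank_eq_coe_rk : M.eRank = (rk M (gr M) : ℕ∞) := by
  rw [coe_rk, coe_gr, Matroid.eRank_def]

omit [DecidableEq α] in
/-- A subset of the ground finset spans iff its rank is the rank of `M`. -/
theorem spanning_iff_rk_eq {X : Finset α} (hX : X ⊆ gr M) :
    M.Spanning (X : Set α) ↔ rk M X = rk M (gr M) := by
  have hXE : (X : Set α) ⊆ M.E := by rw [← coe_gr]; exact_mod_cast hX
  rw [Matroid.spanning_iff_eRk_le hXE, eRank_eq_coe_rk, ← coe_rk]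
  constructor
  · intro h
    exact le_antisymm (rk_mono' hX) (by exact_mod_cast h)
  · intro h
    rw [h]

/-- `↑(gr M \ X) = M.E \ ↑X`. -/
theorem coe_gr_sdiff (X : Finset α) : ((gr M \ X : Finset α) : Set α) = M.E \ (X : Set α) := by
  rw [Finset.coe_sdiff, coe_gr]

/-- Independence in the dual: the complement spans. -/
theorem dual_indep_iff_spanning_compl {X : Finset α} (hX : X ⊆ gr M) :
    (M✶).Indep (X : Set α) ↔ M.Spanning ((gr M \ X : Finset α) : Set α) := by
  have hXE : (X : Set α) ⊆ M.E := by rw [← coe_gr]; exact_mod_cast hX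
  rw [← Matroid.coindep_def, Matroid.coindep_iff_compl_spanning hXE, coe_gr_sdiff]

/-- Spanning in the dual: the complement is independent. -/
theorem dual_spanning_iff_indep_compl {X : Finset α} (hX : X ⊆ gr M) :
    (M✶).Spanning (X : Set α) ↔ M.Indep ((gr M \ X : Finset α) : Set α) := by
  have hY : ((gr M \ X : Finset α) : Set α) ⊆ (M✶).E := by
    rw [Matroid.dual_ground, coe_gr_sdiff]; exact Set.sdiff_subset
  have h := Matroid.coindep_iff_compl_spanning (M := M✶) hY
  rw [Matroid.dual_coindep_iff, Matroid.dual_ground] at h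
  have e : M.E \ ((gr M \ X : Finset α) : Set α) = (X : Set α) := by
    rw [coe_gr_sdiff, Set.sdiff_sdiff_right_self, Set.inter_eq_right]
    rw [← coe_gr]; exact_mod_cast hX
  rw [e] at h
  exact h.symm

/-- The dual of a simple matroid has cogirth `≥ 3`. -/
theorem cogirthGe'_dual_three (hs : Simple' M) : CogirthGe' (M✶) 3 := by
  intro X hX hcard
  rw [gr_dual] at hX hcard ⊢
  have hsp : (M✶).Spanning (X : Set α) := by
    rw [dual_spanning_iff_indep_compl hX]
    exact hs _ sdiff_subset (by omega)
  have h1 : (M✶).eRk (X : Set α) = (M✶).eRank := hsp.eRk_eq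
  rw [eRank_eq_coe_rk (M := M✶), gr_dual, ← coe_rk] at h1
  exact_mod_cast h1


/-- The independent pairs of the dual are the pairs of the simple matroid `M` whose complement spans. -/
theorem indepSets_dual_two (hs : Simple' M) :
    indepSets (M✶) 2 = (indepSets M 2).filter (fun B => rk M (gr M \ B) = rk M (gr M)) := by
  ext B
  rw [mem_indepSets, mem_filter, mem_indepSets, gr_dual]
  constructor
  · rintro ⟨hB, hc, hI⟩
    refine ⟨⟨hB, hc, hs B hB (by omega)⟩, ?_⟩
    rw [← spanning_iff_rk_eq sdiff_subset, ← dual_indep_iff_spanning_compl hB]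
    exact hI
  · rintro ⟨⟨hB, hc, _⟩, hr⟩
    refine ⟨hB, hc, ?_⟩
    rw [dual_indep_iff_spanning_compl hB, spanning_iff_rk_eq sdiff_subset]
    exact hr

omit [DecidableEq α] in
/-- `ρ(M✶) + ρ(M) = |E|`. -/
theorem rk_dual_add_rk : rk (M✶) (gr M) + rk M (gr M) = (gr M).card := by
  have h := Matroid.eRank_add_eRank_dual M
  rw [eRank_eq_coe_rk, eRank_eq_coe_rk (M := M✶), gr_dual, ← coe_gr,
    Set.encard_coe_eq_coe_finsetCard] at h
  have h' : ((rk M (gr M) + rk (M✶) (gr M) : ℕ) : ℕ∞) = ((gr M).card : ℕ∞) := by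
    push_cast; exact h
  have h'' := Nat.cast_injective h'
  omega

/-- The bases of the dual correspond to the bases of `M` by complementation. -/
theorem card_indepSets_dual_rank :
    (indepSets (M✶) (rk (M✶) (gr (M✶)))).card = (indepSets M (rk M (gr M))).card := by
  have hsum := rk_dual_add_rk (M := M)
  apply card_nbij' (fun B => gr M \ B) (fun S => gr M \ S)
  · intro B hB
    rw [Finset.mem_coe, mem_indepSets, gr_dual] at hB
    obtain ⟨hB, hc, hI⟩ := hB
    rw [Finset.mem_coe, mem_indepSets]
    refine ⟨sdiff_subset, ?_, ?_⟩
    · rw [card_sdiff, inter_eq_left.2 hB, hc]; omega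
    · rw [dual_indep_iff_spanning_compl hB, spanning_iff_rk_eq sdiff_subset] at hI
      apply indep_of_rk_eq_card
      rw [hI, card_sdiff, inter_eq_left.2 hB, hc]; omega
  · intro S hS
    rw [Finset.mem_coe, mem_indepSets] at hS
    obtain ⟨hS, hc, hI⟩ := hS
    rw [Finset.mem_coe, mem_indepSets, gr_dual]
    refine ⟨sdiff_subset, ?_, ?_⟩
    · rw [card_sdiff, inter_eq_left.2 hS, hc]; omega
    · rw [dual_indep_iff_spanning_compl sdiff_subset, Finset.sdiff_sdiff_eq_self hS,
        spanning_iff_rk_eq hS, rk_eq_card_of_indep hI, hc]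
  · intro B hB
    rw [Finset.mem_coe, mem_indepSets, gr_dual] at hB
    exact Finset.sdiff_sdiff_eq_self hB.1
  · intro S hS
    rw [Finset.mem_coe, mem_indepSets] at hS
    exact Finset.sdiff_sdiff_eq_self hS.1

omit [DecidableEq α] in
/-- No independent pair on at most one element. -/
theorem indepSets_two_eq_empty_of_card_le (h : (gr M).card ≤ 1) : indepSets M 2 = ∅ := by
  rw [Finset.eq_empty_iff_forall_notMem]
  intro B hB
  rw [mem_indepSets] at hB
  have := card_le_card hB.1
  omega

/-- `INDEP_{2,2}` on every matroid. -/
theorem indep2_two' : Indep2 M 2 := by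
  unfold Indep2
  rw [Nat.choose_self, one_mul]
  calc ∑ B ∈ indepSets M 2, demand M 2 2 B ≤ ∑ B ∈ indepSets M 2, 1 := by
        apply sum_le_sum
        intro B _
        unfold demand
        split_ifs
        · rw [Nat.sub_self, Nat.choose_zero_right]
        · exact Nat.zero_le _
    _ = (indepSets M 2).card := by rw [sum_const, smul_eq_mul, mul_one]

/-- **THE TOP LEVEL (b′)**: on every simple matroid, `INDEP_{2,ρ(E)}` — the coindependent pairs are at most the
bases.  By duality: the coindependent pairs of `M` are the independent pairs of `M✶`, which has cogirth `≥ 3`,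
and Theorem C (`indep_demand_le_choose_mul_card_indepSets`) on `M✶` at its top level counts them against the
bases of `M✶`, i.e. the bases of `M`. -/
theorem indep2_top (hs : Simple' M) : Indep2 M (rk M (gr M)) := by
  classical
  set R := rk M (gr M) with hR
  rcases Nat.lt_or_ge R 3 with hR3 | hR3
  · -- ranks `0, 1, 2`
    rcases Nat.lt_or_ge R 2 with hR2 | hR2
    · -- rank `≤ 1`: at most one element
      have hcard : (gr M).card ≤ 1 := by
        by_contra hgt
        push Not at hgt
        obtain ⟨B, hB, hBc⟩ := Finset.exists_subset_card_eq (s := gr M) (n := 2) hgt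
        have hI := hs B hB (by omega)
        have := rk_eq_card_of_indep hI
        have := rk_mono' (M := M) hB
        omega
      unfold Indep2
      rw [indepSets_two_eq_empty_of_card_le hcard, Finset.sum_empty]
      exact Nat.zero_le _
    · have h2 : R = 2 := by omega
      rw [h2]
      exact indep2_two'
  -- rank `≥ 3`
  have hsum := rk_dual_add_rk (M := M)
  have hgd : rk (M✶) (gr (M✶)) = rk (M✶) (gr M) := by rw [gr_dual]
  set v := rk (M✶) (gr M) with hv
  rcases Nat.lt_or_ge v 2 with hv2 | hv2
  · -- nullity `≤ 1`: the complement of a pair has fewer than `R` elements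
    apply indep2_of_card_le (u := R) (by omega) (by omega)
  -- nullity `≥ 2`
  have hdual : CogirthGe' (M✶) 3 := cogirthGe'_dual_three hs
  have hC := indep_demand_le_choose_mul_card_indepSets (M := M✶) (q := 2) (u := v) hdual hv2
    (by rw [hgd])
  have hdem : ∀ B ∈ indepSets (M✶) 2, demand (M✶) 2 v B = v.choose 2 := by
    intro B hB
    rw [mem_indepSets] at hB
    have hfull : rk (M✶) (gr (M✶) \ B) = rk (M✶) (gr (M✶)) :=
      rk_sdiff_eq_of_card_lt hdual hB.1 (by rw [hB.2.1]; norm_num)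
    unfold demand
    rw [hfull, hgd, if_pos le_rfl, Nat.choose_symm hv2]
  rw [sum_const_nat hdem] at hC
  have hle : (indepSets (M✶) 2).card ≤ (indepSets (M✶) v).card := by
    have hpos : 0 < v.choose 2 := Nat.choose_pos hv2
    rw [mul_comm] at hC
    exact Nat.le_of_mul_le_mul_left hC hpos
  rw [← hgd, card_indepSets_dual_rank] at hle
  -- the demand of `M` at the top level
  unfold Indep2
  have hdemM : ∀ B ∈ indepSets M 2, demand M 2 R B =
      if rk M (gr M \ B) = rk M (gr M) then R.choose 2 else 0 := by
    intro B _
    unfold demand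
    have hle' : rk M (gr M \ B) ≤ rk M (gr M) := rk_mono' sdiff_subset
    by_cases h : rk M (gr M \ B) = rk M (gr M)
    · rw [if_pos h, h, if_pos le_rfl, Nat.choose_symm (by omega)]
    · rw [if_neg h, if_neg (by omega)]
  rw [Finset.sum_congr rfl hdemM, ← Finset.sum_filter, Finset.sum_const, smul_eq_mul,
    ← indepSets_dual_two hs, mul_comm]
  exact Nat.mul_le_mul_left _ hle

/-- **The assembly with the top level discharged**: if every simple matroid with `≥ u + 3` elements and
`u + 1 ≤ ρ(E)` has some element `z` with `DelStep N z u` (`3 ≤ u`), then `INDEP_{2,u}` holds on every simple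
matroid at every level `u ≥ 3`. -/
theorem indep2_of_delStep_exists_below
    (hstep : ∀ (N : Matroid α) [N.Finite], Simple' N → ∀ u : ℕ, 3 ≤ u →
      u + 3 ≤ (gr N).card → u + 1 ≤ rk N (gr N) → ∃ z ∈ gr N, DelStep N z u)
    (hs : Simple' M) {u : ℕ} (hu : 3 ≤ u) : Indep2 M u :=
  indep2_of_delStep_exists (fun _ _ hN => indep2_top hN) hstep (gr M).card M rfl hs u hu

end PercRepro.Cogirth
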